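import Summits.NavierStokesRegularity.NavierStokesRegularity.Theorems.TargetDepletionLadderBoundedStretchingLimit
import Summits.NavierStokesRegularity.NavierStokesRegularity.Theorems.TargetDepletionLadderStubRungOfDepletionByName
import HarnessLib

/-!
# Crux `Target` (stmt-NavierStokesRegularity-1217), line `depletion_ladder` (skeleton of record
# `Cruxes/Target/Lines/depletion_ladder.lean`, sha16 `f7213e70113b3d52`): the registered stub S1
# `stub_depletionBelowHalf` CLOSED BY NAME

`--supports stmt-NavierStokesRegularity-1217` (seat leafhand-ns-poloidalwindowdoor-3 g0, cell decomp-ns). The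
registered stub reads

  `stub_depletionBelowHalf : ∃ κ : ℝ, κ < 1 / 2 ∧ StretchingDepletion κ`

where `StretchingDepletion` is the line-local `def` of the skeleton (l. 58), twinned VERBATIM on the
`Theorems/` side as `Theorems.DepletionLadder.Skeleton.StretchingDepletion`
(`TargetDepletionLadderStubRungOfDepletionByName.lean`, p814268, which closed S2 over the same twin).
Its content — the depletion inequality `|∫⟪ω, Du ω⟫| ≤ κ · M · ‖ω‖₂ · ‖∇ω‖₂` with a constant
`κ < 1/2` for EVERY `C²` divergence-free `u : ℝ³ → ℝ³` bounded by `M` with `curl u ∈ L²`,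
`∇ curl u ∈ L²` and integrable stretching density (no decay of `u`) — is PROVED in the tree with
`κ = (2+√3)/9 = 0.4147…` by this seat's programme:

* P1 `…BoundedBiotSavart` (`u = c + K₃ ∗ ω`), P2 `…BoundedDivCurl` (`∫|Du|²_F = ∫‖ω‖²`),
  P3 `…BoundedSobolevData` (`D¹u, D²u ∈ L²`), P4 `…BoundedSharpDepletion` (the tree's strain-cube
  chain without its `u ∈ L²` hypothesis), P5 `…BoundedMollified` (the bound for `ρ ⋆ u` with the data
  of `u`), `…BoundedLFour` + `…BoundedStretchingLimit` (continuity of the stretching integral under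
  mollification) ⟹ `BoundedStretchingLimit.abs_integral_stretching_le_sharp_of_registered`.

* `stub_depletionBelowHalf` — ★ the registered stub S1 BY NAME (exact header of the skeleton,
  l. 94), witness `κ = (2+√3)/9`, `sharp_lt_half : (2+√3)/9 < 1/2`.
* `rung_two` — with S2 (`Skeleton.stub_rung_of_depletion`, p814268) the skeleton's node RUNG TWO
  `Rung 2` over the twins (already a tree theorem as `stub_rungTwo`, p538781; recorded for the
  skeleton's composition: after this file `Target_of` is closed modulo the residual S3
  `stub_descentToRungTwo` = the crux above rung two, by `noTypeIBlowup_iff_rungTwo_and_descent`).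

HONEST LABEL: one registered stub of one leaf closed by name (the line's load-bearing NEW stub: an
`L^∞`-constrained depletion constant strictly below the enstrophy value `1`, indeed below `1/2`); the
crux `Target` (no Type-I blow-up) is EXACTLY the open residual S3; NS regularity is NOT proved.
-/

noncomputable section

-- the summit and its single sub-problem share the name (CONVENTIONS §1)
set_option linter.dupNamespace false

open Set Filter Topology MeasureTheory
open scoped RealInnerProductSpace
open Literature.Analysis.FluidPDE

namespace Summit.NavierStokesRegularity.NavierStokesRegularity.Theorems.DepletionLadder.Skeleton

open Summit.NavierStokesRegularity.NavierStokesRegularity.Theorems.DepletionLadder.BoundedSharpDepletion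
open Summit.NavierStokesRegularity.NavierStokesRegularity.Theorems.DepletionLadder.BoundedStretchingLimit

/-- **The twinned depletion inequality holds with `κ = (2+√3)/9`.** [folklore] -/
theorem stretchingDepletion_sharp : StretchingDepletion ((2 + Real.sqrt 3) / 9) :=
  fun _u _M hu hdiv hM hZ hP hJ => abs_integral_stretching_le_sharp_of_registered hu hdiv hM hZ hP hJ

/-- ★ **The registered stub S1 `stub_depletionBelowHalf` of crux stmt-NavierStokesRegularity-1217 BY
NAME** (exact header of the skeleton `Cruxes/Target/Lines/depletion_ladder.lean`, l. 94): there is a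
depletion constant `κ < 1/2` — witness `κ = (2+√3)/9 = 0.4147…`, valid for every `C²` bounded
divergence-free field with `curl u ∈ H¹` and integrable stretching density. [folklore] -/
theorem stub_depletionBelowHalf : ∃ κ : ℝ, κ < 1 / 2 ∧ StretchingDepletion κ :=
  ⟨(2 + Real.sqrt 3) / 9, sharp_lt_half, stretchingDepletion_sharp⟩

/-- **RUNG TWO over the twins** from S1 (this file) and S2 (p814268): `Rung 2` — an eventual
dimensionless rate `√(T−t)‖u(t,x)‖ ≤ 2√ν` forces a smooth extension past `T`. [folklore] -/
theorem rung_two : Rung 2 :=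
  rung_two_of_depletionBelowHalf stub_depletionBelowHalf

end Summit.NavierStokesRegularity.NavierStokesRegularity.Theorems.DepletionLadder.Skeleton

end
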